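import Literature.Geometry.Lorentzian.KerrHyperboloidalLeaves
import Literature.Analysis.FunctionSpaces.SobolevSupBoundDomain
import Literature.Analysis.FunctionSpaces.ExteriorLipschitzDomain
import HarnessLib

/-!
# The Kerr–Schild slice balls `{r₊ < r} ∩ {‖y‖ < R}` are bounded Lipschitz domains:
# the solid horizon ellipsoid, and Sobolev's inequality on the slice portions

(statement group **gr.S24**, infrastructure; namespace `Literature.Geometry.Lorentzian.Kerr`)

Support file for the Sobolev step in the decomposition of the pointwise derivative estimate (31)
of Dafermos–Rodnianski–Shlapentokh-Rothman (arXiv:1402.7034 = Ann. of Math. 183 (2016), §3.3,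
Cor. 3.1; vendored as `Literature.Geometry.Lorentzian.drsr_wave_derivative_decay_kerr`,
`KerrWaveDecay.lean`), carried out in `KerrDerivativeDecaySobolev.lean`: DRSR obtain pointwise
bounds from energy bounds "in view of the Sobolev inequality applied on each `Σ_τ`" (p. 14 of the
arXiv text), on the compact portions `Σ_τ ∩ {r ≤ R}` — manifolds with boundary reaching the
horizon sphere. In the Cartesian parametrisation `y ∈ E3` of the Kerr–Schild slices `{t*_KS = τ}`
(which the hyperboloidal leaves `Σ̃_τ(h♯_{R₁})` of `KerrHyperboloidalFlux.lean` *are* on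
`{r ≤ R₁}`) these portions are the **slice balls** `{y | r(0, y) > r₊, ‖y‖ < R}`: an open ball with
the closed solid horizon ellipsoid removed. The tree's Sobolev imbedding
`W^{2,2}(Ω) → C_B(Ω)` (`Literature.Analysis.FunctionSpaces.exists_forall_enorm_le_eSobolevDomainNorm_two`,
Adams 1975, Thm. 5.4, on bounded Lipschitz domains of `ℝ³`) therefore applies once the slice balls
are known to be bounded Lipschitz domains, which is what this file proves:

* `Kerr.horizonQuadric M a y = (y₁² + y₂²)/(r₊² + a²) + y₃²/r₊²`, `Kerr.horizonEllipsoidInterior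
  = {q < 1}` (convex, bounded by `2M` for `|a| < M`, with closure `{q ≤ 1}`), and
  `Kerr.mem_slice_rPlus_iff` (**proved**): `r(0, y) > r₊ ↔ q(y) > 1` — the exterior slice
  `Kerr.slice a r₊` is the exterior of the closed solid horizon ellipsoid (O'Neill 1995, Ch. 2,
  §2.1: the level sets `{r = c}` of the Kerr–Schild radius are the confocal ellipsoids
  `(x² + y²)/(c² + a²) + z²/c² = 1`; the defining quartic `r⁴ − (‖y‖² − a²) r² − a² y₃² = 0`,
  `Kerr.radius_quartic`, and the monotonicity of `c ↦ (y₁² + y₂²)/(c² + a²) + y₃²/c²`);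
* `Kerr.sliceBall M a R = Kerr.slice a r₊ ⊓ B(0, R)`, `Kerr.isLipschitzDomain_sliceBall` (**proved**,
  for `R > 2M`, from `isLipschitzDomain_ball_inf_outerDomain_of_convex` of
  `Literature/Analysis/FunctionSpaces/ExteriorLipschitzDomain.lean`), `Kerr.isBounded_sliceBall`,
  and `Kerr.exists_enorm_le_eSobolevDomainNorm_sliceBall` (**proved**): there is `K < ∞` with
  `‖f(y)‖ ≤ K ‖f‖_{W^{2,2}(sliceBall)}` on the slice ball for every real `f ∈ W^{2,2}` continuous
  there.

## Design choices

* The threshold `R > 2M` only ensures that the hole `{q ≤ 1} ⊆ {‖y‖ ≤ 2M}` (semi-axes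
  `√(r₊² + a²) = √(2Mr₊)` and `r₊`, both `≤ 2M`) misses the outer sphere; the radii of interest are
  eventually large.
* Real-variable cores (`horizonQuadric_aux_gt`, `horizonQuadric_aux_le`) isolate the polynomial
  inequalities behind `mem_slice_rPlus_iff` (cleared denominators; `linarith` on explicit products).
* Binders use `Kerr.slice a (Kerr.rPlus M a)`; `E3 = EuclideanSpace ℝ (Fin 3)` carries Lebesgue
  measure `volume` (an additive Haar measure) and `finrank ℝ E3 = 3` (`finrank_euclideanSpace_fin`).

## Mathlib / tree search

Mathlib (this pin): `Even.convexOn_pow`, `ConvexOn.comp_linearMap`, `ConvexOn.convex_lt`,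
`closure_lt_subset_le`, `image_closure_subset_closure_image`, `EuclideanSpace.norm_sq_eq`; no
Sobolev spaces on domains. Tree: `Kerr.radius_quartic`, `Kerr.radius_sq`,
`Kerr.IsSubextremal.rPlus_pos`, `Kerr.IsSubextremal.rPlus_sq`, `Kerr.rPlus_le_two_mul`,
`Kerr.slice_eq_image_spheroidal` (`KerrDataProofs.lean`, the spheroidal parametrisation — a
different rendering of the same ellipsoids, not reused here), the Sobolev files of
`Literature/Analysis/FunctionSpaces/`.

## References

* M. Dafermos, I. Rodnianski, Y. Shlapentokh-Rothman, arXiv:1402.7034, §3.3 Cor. 3.1, p. 14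
  (key `DafermosRodnianskiShlapentokhrothman2014`).
* B. O'Neill, *The geometry of Kerr black holes*, A K Peters (1995), Ch. 2, §2.1 (key `ONeill1995`);
  M. Visser, *The Kerr spacetime: a brief introduction*, arXiv:0706.0622, (35).
* R. A. Adams, *Sobolev Spaces* (1975), Thm. 5.4 Part I Case C (8) (key `Adams1975`).
* P. Grisvard, *Elliptic problems in nonsmooth domains* (1985), §1.2.1 (key `Grisvard1985`);
  M. S. Agranovich, *Sobolev Spaces, Their Generalizations and Elliptic Problems in Smooth and
  Lipschitz Domains* (2015), §9.1.
-/

noncomputable section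

open Set Filter TopologicalSpace MeasureTheory Metric
open scoped Topology ENNReal Manifold ContDiff

namespace Literature.Geometry.Lorentzian

namespace Kerr

/-! ### The solid horizon ellipsoid and the exterior slice -/

/-- The **horizon quadric** `q(y) = (y₁² + y₂²)/(r₊² + a²) + y₃²/r₊²` on `E3`: the level set
`{q = 1}` is the horizon sphere `{r = r₊}` of the Kerr–Schild slice `{t* = 0}`, the confocal
ellipsoid (oblate spheroid) of semi-axes `√(r₊² + a²)`, `r₊` (O'Neill 1995, Ch. 2, §2.1: the
level sets `{r = c}` of the Kerr–Schild radius are the ellipsoids `(x² + y²)/(c² + a²) + z²/c² = 1`;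
Visser arXiv:0706.0622, (35)). [cite: ONeill1995, Ch. 2 §2.1] -/
def horizonQuadric (M a : ℝ) (y : E3) : ℝ :=
  (y 0 ^ 2 + y 1 ^ 2) / (rPlus M a ^ 2 + a ^ 2) + y 2 ^ 2 / rPlus M a ^ 2

/-- The horizon quadric is continuous. [folklore] -/
theorem continuous_horizonQuadric (M a : ℝ) : Continuous (horizonQuadric M a) := by
  unfold horizonQuadric
  fun_prop

/-- The horizon quadric is homogeneous of degree two: `q(t y) = t² q(y)`. [folklore] -/
theorem horizonQuadric_smul (M a t : ℝ) (y : E3) :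
    horizonQuadric M a (t • y) = t ^ 2 * horizonQuadric M a y := by
  simp only [horizonQuadric, PiLp.smul_apply, smul_eq_mul]
  ring

/-- The horizon quadric is a convex function (a positive semi-definite quadratic form: a
nonnegative combination of the squares of the coordinate functionals). [folklore] -/
theorem convexOn_horizonQuadric (M a : ℝ) : ConvexOn ℝ univ (horizonQuadric M a) := by
  have hsq : ∀ i : Fin 3, ConvexOn ℝ univ (fun y : E3 => y i ^ 2) := fun i => by
    have h := (Even.convexOn_pow (𝕜 := ℝ) even_two).comp_linearMap
      (EuclideanSpace.proj (𝕜 := ℝ) i).toLinearMap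
    simpa [Set.preimage_univ, Function.comp_def] using h
  have hA : 0 ≤ (rPlus M a ^ 2 + a ^ 2)⁻¹ := by positivity
  have hB : 0 ≤ (rPlus M a ^ 2)⁻¹ := by positivity
  have h := (((hsq 0).add (hsq 1)).smul hA).add ((hsq 2).smul hB)
  refine h.congr fun y _ => ?_
  simp only [horizonQuadric, Pi.add_apply, smul_eq_mul]
  ring

/-- The **open solid horizon ellipsoid** `{q < 1} ⊆ E3` (the part `{r < r₊}` of the slice
`{t* = 0}` together with the disc `{r = 0}`; O'Neill 1995, Ch. 2, §2.1). [cite: ONeill1995, Ch. 2 §2.1] -/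
def horizonEllipsoidInterior (M a : ℝ) : Opens E3 :=
  ⟨{y | horizonQuadric M a y < 1}, isOpen_lt (continuous_horizonQuadric M a) continuous_const⟩

/-- Membership in the open solid horizon ellipsoid. [folklore] -/
@[simp]
theorem mem_horizonEllipsoidInterior {M a : ℝ} {y : E3} :
    y ∈ horizonEllipsoidInterior M a ↔ horizonQuadric M a y < 1 := Iff.rfl

/-- The open solid horizon ellipsoid is convex (a strict sublevel set of a convex function).
[folklore] -/
theorem convex_horizonEllipsoidInterior (M a : ℝ) :
    Convex ℝ (horizonEllipsoidInterior M a : Set E3) := by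
  have h := (convexOn_horizonQuadric M a).convex_lt 1
  simp only [mem_univ, true_and] at h
  exact h

/-- `‖y‖² ≤ (r₊² + a²) q(y)`: the horizon quadric dominates the Euclidean square norm divided by
the square of the larger semi-axis. [folklore] -/
theorem norm_sq_le_mul_horizonQuadric {M a : ℝ} (hr : 0 < rPlus M a) (y : E3) :
    ‖y‖ ^ 2 ≤ (rPlus M a ^ 2 + a ^ 2) * horizonQuadric M a y := by
  have hn : ‖y‖ ^ 2 = y 0 ^ 2 + y 1 ^ 2 + y 2 ^ 2 := by
    rw [EuclideanSpace.norm_sq_eq, Fin.sum_univ_three]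
    simp only [Real.norm_eq_abs, sq_abs]
  have hB : 0 < rPlus M a ^ 2 := by positivity
  have hA : 0 < rPlus M a ^ 2 + a ^ 2 := by positivity
  have h2 : y 2 ^ 2 / rPlus M a ^ 2 ≥ y 2 ^ 2 / (rPlus M a ^ 2 + a ^ 2) :=
    div_le_div_of_nonneg_left (sq_nonneg _) hB (by nlinarith [sq_nonneg a])
  unfold horizonQuadric
  rw [hn, mul_add, mul_div_cancel₀ _ hA.ne']
  have h3 : (rPlus M a ^ 2 + a ^ 2) * (y 2 ^ 2 / rPlus M a ^ 2) ≥ y 2 ^ 2 := by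
    calc (rPlus M a ^ 2 + a ^ 2) * (y 2 ^ 2 / rPlus M a ^ 2)
        ≥ (rPlus M a ^ 2 + a ^ 2) * (y 2 ^ 2 / (rPlus M a ^ 2 + a ^ 2)) :=
          mul_le_mul_of_nonneg_left h2 hA.le
      _ = y 2 ^ 2 := mul_div_cancel₀ _ hA.ne'
  linarith

/-- For subextremal parameters the solid horizon ellipsoid `{q ≤ 1}` lies in the closed ball of
radius `2M` (its semi-axes are `√(r₊² + a²) = √(2Mr₊) ≤ 2M` and `r₊ ≤ 2M`). [folklore] -/
theorem norm_le_two_mul_of_horizonQuadric_le_one {M a : ℝ} (hMa : IsSubextremal M a) {y : E3}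
    (hy : horizonQuadric M a y ≤ 1) : ‖y‖ ≤ 2 * M := by
  have hM : 0 < M := hMa.pos
  have hr : 0 < rPlus M a := hMa.rPlus_pos
  have hsq : rPlus M a ^ 2 + a ^ 2 = 2 * M * rPlus M a := by
    have := hMa.rPlus_sq; linarith
  have hr2 : rPlus M a ≤ 2 * M := rPlus_le_two_mul hM.le
  have h1 := norm_sq_le_mul_horizonQuadric hr y
  have h2 : ‖y‖ ^ 2 ≤ (2 * M) ^ 2 := by
    calc ‖y‖ ^ 2 ≤ (rPlus M a ^ 2 + a ^ 2) * horizonQuadric M a y := h1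
      _ ≤ (rPlus M a ^ 2 + a ^ 2) * 1 := by gcongr
      _ = 2 * M * rPlus M a := by rw [mul_one, hsq]
      _ ≤ (2 * M) ^ 2 := by nlinarith
  exact (pow_le_pow_iff_left₀ (norm_nonneg y) (by positivity) two_ne_zero).1 h2

/-- The open solid horizon ellipsoid is bounded. [folklore] -/
theorem isBounded_horizonEllipsoidInterior {M a : ℝ} (hMa : IsSubextremal M a) :
    Bornology.IsBounded (horizonEllipsoidInterior M a : Set E3) :=
  (isBounded_closedBall (x := (0 : E3)) (r := 2 * M)).subset fun _ hy =>
    mem_closedBall_zero_iff.2 (norm_le_two_mul_of_horizonQuadric_le_one hMa (le_of_lt hy))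

/-- The closure of the open solid horizon ellipsoid is the closed one: `closure {q < 1} = {q ≤ 1}`
(a point with `q(y) = 1` is the limit of the interior points `t y`, `t ↑ 1`, `q(t y) = t² < 1`).
[folklore] -/
theorem closure_horizonEllipsoidInterior (M a : ℝ) :
    closure (horizonEllipsoidInterior M a : Set E3) = {y | horizonQuadric M a y ≤ 1} := by
  apply Subset.antisymm
  · exact closure_lt_subset_le (continuous_horizonQuadric M a) continuous_const
  · intro y hy
    -- `y = 1 • y` is a limit of the points `t • y`, `t ∈ (0, 1)`, which lie in `{q < 1}`
    have hf : Continuous fun t : ℝ => t • y := continuous_id.smul continuous_const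
    have himage : (fun t : ℝ => t • y) '' Ioo (0 : ℝ) 1 ⊆ (horizonEllipsoidInterior M a : Set E3) := by
      rintro _ ⟨t, ht, rfl⟩
      show horizonQuadric M a (t • y) < 1
      rw [horizonQuadric_smul]
      have hy' : horizonQuadric M a y ≤ 1 := hy
      have ht2 : t ^ 2 < 1 := by nlinarith [ht.1, ht.2]
      calc t ^ 2 * horizonQuadric M a y ≤ t ^ 2 * 1 :=
            mul_le_mul_of_nonneg_left hy' (sq_nonneg t)
        _ < 1 := by rw [mul_one]; exact ht2
    have h1 : y ∈ (fun t : ℝ => t • y) '' closure (Ioo (0 : ℝ) 1) :=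
      ⟨1, by rw [closure_Ioo zero_ne_one]; exact ⟨zero_le_one, le_rfl⟩, one_smul _ _⟩
    exact closure_mono himage (image_closure_subset_closure_image hf h1)

/-- Real-variable core of `mem_slice_rPlus_iff`, outward direction: if `0 < r₊ < r`, `z ≥ 0`
and `r² ρ = (r² + a²)(r² − z)` (the defining quartic of the Kerr–Schild radius with
`ρ = y₁² + y₂²`, `z = y₃²`), then `(r₊² + a²) r₊² < ρ r₊² + (r₊² + a²) z`, i.e. `q(y) > 1`. [folklore] -/
theorem horizonQuadric_aux_gt {rp r a ρ z : ℝ} (hrp : 0 < rp) (hlt : rp < r) (hz : 0 ≤ z)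
    (hquart : r ^ 2 * ρ = (r ^ 2 + a ^ 2) * (r ^ 2 - z)) :
    (rp ^ 2 + a ^ 2) * rp ^ 2 < ρ * rp ^ 2 + (rp ^ 2 + a ^ 2) * z := by
  have hr : 0 < r := hrp.trans hlt
  have hrr : rp ^ 2 < r ^ 2 := by nlinarith
  have e : (ρ * rp ^ 2 + (rp ^ 2 + a ^ 2) * z) * r ^ 2 =
      rp ^ 2 * (r ^ 2 + a ^ 2) * r ^ 2 + z * a ^ 2 * (r ^ 2 - rp ^ 2) := by
    linear_combination rp ^ 2 * hquart
  have P1 : 0 < (r ^ 2 - rp ^ 2) * (rp ^ 2 * r ^ 2) := mul_pos (sub_pos.2 hrr) (by positivity)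
  have P2 : 0 ≤ (r ^ 2 - rp ^ 2) * (z * a ^ 2) := mul_nonneg (sub_pos.2 hrr).le (by positivity)
  have key : (rp ^ 2 + a ^ 2) * rp ^ 2 * r ^ 2 < (ρ * rp ^ 2 + (rp ^ 2 + a ^ 2) * z) * r ^ 2 := by
    rw [e]; linarith [P1, P2]
  exact lt_of_mul_lt_mul_right key (sq_nonneg r)

/-- Real-variable core of `mem_slice_rPlus_iff`, inward direction: if `0 < r ≤ r₊`, `z ≥ 0` and
`r² ρ = (r² + a²)(r² − z)`, then `ρ r₊² + (r₊² + a²) z ≤ (r₊² + a²) r₊²`, i.e. `q(y) ≤ 1`. [folklore] -/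
theorem horizonQuadric_aux_le {rp r a ρ z : ℝ} (hr : 0 < r) (hle : r ≤ rp) (hz : 0 ≤ z)
    (hquart : r ^ 2 * ρ = (r ^ 2 + a ^ 2) * (r ^ 2 - z)) :
    ρ * rp ^ 2 + (rp ^ 2 + a ^ 2) * z ≤ (rp ^ 2 + a ^ 2) * rp ^ 2 := by
  have hrr : r ^ 2 ≤ rp ^ 2 := by nlinarith
  have e : (ρ * rp ^ 2 + (rp ^ 2 + a ^ 2) * z) * r ^ 2 =
      rp ^ 2 * (r ^ 2 + a ^ 2) * r ^ 2 + z * a ^ 2 * (r ^ 2 - rp ^ 2) := by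
    linear_combination rp ^ 2 * hquart
  have P1 : 0 ≤ (rp ^ 2 - r ^ 2) * (rp ^ 2 * r ^ 2) := mul_nonneg (sub_nonneg.2 hrr) (by positivity)
  have P2 : 0 ≤ (rp ^ 2 - r ^ 2) * (z * a ^ 2) := mul_nonneg (sub_nonneg.2 hrr) (by positivity)
  have key : (ρ * rp ^ 2 + (rp ^ 2 + a ^ 2) * z) * r ^ 2 ≤ (rp ^ 2 + a ^ 2) * rp ^ 2 * r ^ 2 := by
    rw [e]; linarith [P1, P2]
  exact le_of_mul_le_mul_right key (by positivity)

/-- **The exterior slice is the exterior of the solid horizon ellipsoid**: for subextremal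
`(M, a)` and `y ∈ E3`, `r(0, y) > r₊ ↔ q(y) > 1`. The Kerr–Schild radius `r = r(0, y) ≥ 0`
solves `r⁴ − (‖y‖² − a²) r² − a² y₃² = 0`, i.e. (for `r > 0`)
`(y₁² + y₂²)/(r² + a²) + y₃²/r² = 1`, and `c ↦ (y₁² + y₂²)/(c² + a²) + y₃²/c²` is decreasing
(`horizonQuadric_aux_gt`, `horizonQuadric_aux_le`); the root `r = 0` occurs only on the disc
`{y₃ = 0, ‖y‖ ≤ |a|}`, where `q < 1`. O'Neill 1995, Ch. 2, §2.1; Visser arXiv:0706.0622, (35). [cite: ONeill1995, Ch. 2 §2.1] -/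
theorem mem_slice_rPlus_iff {M a : ℝ} (hMa : IsSubextremal M a) {y : E3} :
    y ∈ slice a (rPlus M a) ↔ 1 < horizonQuadric M a y := by
  have hrp : 0 < rPlus M a := hMa.rPlus_pos
  set r : ℝ := radius a (E4.ofTimeSpace 0 y) with hr_def
  have hr0 : 0 ≤ r := radius_nonneg a _
  -- the defining quartic in the coordinates of `y`
  have hn : ‖y‖ ^ 2 = y 0 ^ 2 + y 1 ^ 2 + y 2 ^ 2 := by
    rw [EuclideanSpace.norm_sq_eq, Fin.sum_univ_three]
    simp only [Real.norm_eq_abs, sq_abs]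
  have h3 : (E4.ofTimeSpace 0 y : E4) 3 = y 2 := E4.ofTimeSpace_apply_succ 0 y 2
  have hquart : r ^ 2 * (y 0 ^ 2 + y 1 ^ 2) = (r ^ 2 + a ^ 2) * (r ^ 2 - y 2 ^ 2) := by
    have hq := radius_quartic a (E4.ofTimeSpace 0 y)
    rw [E4.spatialNorm_ofTimeSpace, h3, hn, ← hr_def] at hq
    linear_combination -hq
  have hmem : y ∈ slice a (rPlus M a) ↔ rPlus M a < r := by
    rw [mem_slice, ← hr_def, max_eq_left hrp.le]
  have hA : 0 < rPlus M a ^ 2 + a ^ 2 := by positivity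
  have hB : 0 < rPlus M a ^ 2 := by positivity
  have hz : 0 ≤ y 2 ^ 2 := sq_nonneg _
  have hρ : 0 ≤ y 0 ^ 2 + y 1 ^ 2 := by positivity
  rw [hmem, horizonQuadric, div_add_div _ _ hA.ne' hB.ne', one_lt_div (mul_pos hA hB)]
  constructor
  · intro hlt
    exact horizonQuadric_aux_gt hrp hlt hz hquart
  · intro hgt
    by_contra hle
    rw [not_lt] at hle
    rcases hr0.lt_or_eq with hrpos | hr00
    · exact absurd hgt (not_lt.2 (horizonQuadric_aux_le hrpos hle hz hquart))
    · -- `r = 0`: `y` lies on the disc `{y₃ = 0, ‖y‖ ≤ |a|}`, where `q < 1`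
      have hr0' : r = 0 := hr00.symm
      have haz : a ^ 2 * y 2 ^ 2 = 0 := by
        have hq4 := radius_quartic a (E4.ofTimeSpace 0 y)
        rw [← hr_def, h3, hr0'] at hq4
        linarith
      have hdisc : y 0 ^ 2 + y 1 ^ 2 + y 2 ^ 2 ≤ a ^ 2 := by
        have hsq := radius_sq a (E4.ofTimeSpace 0 y)
        rw [← hr_def, hr0', E4.spatialNorm_ofTimeSpace, h3, hn] at hsq
        have hD : (y 0 ^ 2 + y 1 ^ 2 + y 2 ^ 2 - a ^ 2) ^ 2 + 4 * a ^ 2 * y 2 ^ 2 =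
            (y 0 ^ 2 + y 1 ^ 2 + y 2 ^ 2 - a ^ 2) ^ 2 := by linear_combination 4 * haz
        rw [hD, Real.sqrt_sq_eq_abs] at hsq
        linarith [le_abs_self (y 0 ^ 2 + y 1 ^ 2 + y 2 ^ 2 - a ^ 2)]
      rcases eq_or_ne a 0 with ha | ha
      · -- `a = 0`: then `y = 0` and `q(y) = 0`
        rw [ha] at hdisc
        have h0 : y 0 ^ 2 + y 1 ^ 2 = 0 := by linarith
        have h2 : y 2 ^ 2 = 0 := by linarith
        rw [h0, h2, zero_mul, mul_zero, add_zero] at hgt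
        exact absurd hgt (not_lt.2 (mul_pos hA hB).le)
      · -- `a ≠ 0`: then `y₃ = 0`, `y₁² + y₂² ≤ a² < r₊² + a²`
        have h2 : y 2 ^ 2 = 0 := by
          rcases mul_eq_zero.1 haz with h | h
          · exact absurd (pow_eq_zero_iff two_ne_zero |>.1 h) ha
          · exact h
        rw [h2, mul_zero, add_zero] at hgt
        rw [h2, add_zero] at hdisc
        have h1 : (y 0 ^ 2 + y 1 ^ 2) * rPlus M a ^ 2 ≤ a ^ 2 * rPlus M a ^ 2 :=
          mul_le_mul_of_nonneg_right hdisc hB.le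
        have h4 : a ^ 2 * rPlus M a ^ 2 < (rPlus M a ^ 2 + a ^ 2) * rPlus M a ^ 2 := by
          have : 0 < rPlus M a ^ 2 * rPlus M a ^ 2 := by positivity
          linarith
        linarith

/-- The exterior slice as a set: `{r(0, ·) > r₊} = (closure {q < 1})ᶜ = {q ≤ 1}ᶜ` for
subextremal parameters. [folklore] -/
theorem coe_slice_rPlus_eq_compl_closure {M a : ℝ} (hMa : IsSubextremal M a) :
    (slice a (rPlus M a) : Set E3) = (closure (horizonEllipsoidInterior M a : Set E3))ᶜ := by
  rw [closure_horizonEllipsoidInterior]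
  ext y
  rw [SetLike.mem_coe, mem_slice_rPlus_iff hMa, mem_compl_iff, mem_setOf_eq, not_le]

/-! ### The slice balls `{r₊ < r} ∩ {‖y‖ < R}` are bounded Lipschitz domains -/

/-- The **slice ball** `{y ∈ E3 | r(0, y) > r₊, ‖y‖ < R}`: the portion of the exterior
Kerr–Schild slice inside the open coordinate ball of radius `R` (the Cartesian parametrisation of
`Σ_τ ∩ {‖y‖ < R}` for every `τ`; a ball with the closed solid horizon ellipsoid removed). DRSR
arXiv:1402.7034, §3.3 (the regions `Σ̃_τ ∩ {r ≤ R}`). [folklore] -/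
def sliceBall (M a R : ℝ) : Opens E3 :=
  slice a (rPlus M a) ⊓ ⟨ball 0 R, isOpen_ball⟩

/-- The underlying set of the slice ball. [folklore] -/
@[simp]
theorem coe_sliceBall (M a R : ℝ) :
    (sliceBall M a R : Set E3) = (slice a (rPlus M a) : Set E3) ∩ ball 0 R := rfl

/-- Membership in the slice ball. [folklore] -/
theorem mem_sliceBall_iff {M a R : ℝ} {y : E3} :
    y ∈ sliceBall M a R ↔ y ∈ slice a (rPlus M a) ∧ ‖y‖ < R := by
  rw [← SetLike.mem_coe, coe_sliceBall, mem_inter_iff, mem_ball_zero_iff]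
  rfl

/-- The slice ball is the shell `B(0, R) ∩ (closure {q < 1})ᶜ` of
`ExteriorLipschitzDomain.lean`. [folklore] -/
theorem sliceBall_eq_ball_inf_outerDomain {M a : ℝ} (hMa : IsSubextremal M a) (R : ℝ) :
    sliceBall M a R = (⟨ball 0 R, isOpen_ball⟩ : Opens E3) ⊓
      Literature.Analysis.FunctionSpaces.outerDomain (horizonEllipsoidInterior M a) := by
  apply Opens.ext
  simp only [Opens.coe_inf, coe_sliceBall, Literature.Analysis.FunctionSpaces.coe_outerDomain,
    Opens.coe_mk]
  rw [← coe_slice_rPlus_eq_compl_closure hMa, inter_comm]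

/-- **The slice balls are Lipschitz domains**: for subextremal `(M, a)` and `R > 2M` (so that the
closed solid horizon ellipsoid, contained in `{‖y‖ ≤ 2M}`, lies inside the open ball), the open
set `{r(0, ·) > r₊} ∩ {‖y‖ < R}` is a Lipschitz domain (a ball minus the closure of a bounded
convex open set compactly inside it, `isLipschitzDomain_ball_inf_outerDomain_of_convex`).
Grisvard 1985, §1.2.1; Agranovich 2015, §9.1. [folklore] -/
theorem isLipschitzDomain_sliceBall {M a R : ℝ} (hMa : IsSubextremal M a) (hR : 2 * M < R) :
    Literature.Analysis.FunctionSpaces.IsLipschitzDomain (sliceBall M a R) := by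
  rw [sliceBall_eq_ball_inf_outerDomain hMa]
  refine Literature.Analysis.FunctionSpaces.isLipschitzDomain_ball_inf_outerDomain_of_convex
    (convex_horizonEllipsoidInterior M a) (isBounded_horizonEllipsoidInterior hMa) ?_
  rw [closure_horizonEllipsoidInterior]
  intro y hy
  exact mem_ball_zero_iff.2 ((norm_le_two_mul_of_horizonQuadric_le_one hMa hy).trans_lt hR)

/-- The slice balls are bounded. [folklore] -/
theorem isBounded_sliceBall (M a R : ℝ) : Bornology.IsBounded (sliceBall M a R : Set E3) := by
  rw [coe_sliceBall]
  exact isBounded_ball.subset inter_subset_right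

/-- **Sobolev's inequality on the slice balls** (`W^{2,2} ⊂ C_B` on the bounded Lipschitz domain
`{r₊ < r} ∩ {‖y‖ < R}` of `ℝ³`; Adams, *Sobolev Spaces* (1975), Thm. 5.4 Part I Case C (8) with
`m = p = 2`, `n = 3`, the tree's `exists_forall_enorm_le_eSobolevDomainNorm_two`): for subextremal
`(M, a)` and `R > 2M` there is `K < ∞` with `‖f(y)‖ ≤ K ‖f‖_{W^{2,2}(sliceBall)}` at every point of
the slice ball, for every real `f ∈ W^{2,2}` continuous there. This is the Sobolev inequality
"applied on each `Σ_τ`" of DRSR (arXiv:1402.7034, p. 14), in Cartesian form on the compact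
portions `{r ≤ R}`. [cite: Adams1975, Thm. 5.4 Part I Case C (8) (p. 89)] -/
theorem exists_enorm_le_eSobolevDomainNorm_sliceBall {M a R : ℝ} (hMa : IsSubextremal M a)
    (hR : 2 * M < R) :
    ∃ K : ℝ≥0∞, K < ⊤ ∧ ∀ f : E3 → ℝ,
      Literature.Analysis.FunctionSpaces.MemSobolevDomain 2 2 (sliceBall M a R) volume f →
      ContinuousOn f (sliceBall M a R : Set E3) → ∀ y ∈ sliceBall M a R,
        ‖f y‖ₑ ≤ K * Literature.Analysis.FunctionSpaces.eSobolevDomainNorm 2 2 (sliceBall M a R)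
          volume f :=
  Literature.Analysis.FunctionSpaces.exists_forall_enorm_le_eSobolevDomainNorm_two
    (volume : Measure E3) (F := ℝ) finrank_euclideanSpace_fin (isLipschitzDomain_sliceBall hMa hR)
    (isBounded_sliceBall M a R)

end Kerr

end Literature.Geometry.Lorentzian

end
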